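import Summits.QuantumFields.YangMills.Theorems.UnitScaleTiltFluctuationComparisonRegPrRepAtHeightsChiV3Fam
import Summits.QuantumFields.YangMills.Theorems.UnitScaleTiltFluctuationComparisonRegPrIntLOnChi
import Summits.QuantumFields.YangMills.Theorems.UnitScaleTiltInteriorExcisionInner
import Summits.QuantumFields.YangMills.Theorems.UnitScaleTiltFluctuationComparisonRegPrOneStepSubmersion
import HarnessLib

/-!
# `UnitScaleTiltFluctuationComparisonRegPrIntLChiV3` — v5kC §2 BY NAME: the record-free engine `InteriorExcision.regPrIntL_of_dataOnPrintChi` (p550585) INSTANTIATED AT THE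
# χ-RECORD — «STUB 1 ∧ T8 ∧ 2′χ ∧ 3⁗χ ∧ (i*)χ ⟹ FluctuationComparisonRegPrIntL» (crux `FluctuationComparisonRegPrIntL`, stmt-QuantumFields-20520; R-57χ, OWNER RULING g23-№2 +
# ADD. 6/7; width-lever lane `ym-ust-19935-r1` g3, «(R1) print's χ of [Balaban1985UV3] (47) back»)

Count-neutral helper (`--supports stmt-QuantumFields-20520`); registry untouched; no numerics.  = the v3 template `…IntLOnChiV3` (p551350) with the three token swaps of ADD. 6
(`AlphaInputsT3ACv3Rec ↦ AlphaInputsT3ACv3RecChi`, `OfV3At ↦ OfV3ChiAt`, `PkgAtV3 ↦ PkgAtV3Chi`, `dataOfV3 ↦ dataOfV3chi`) and conjunct (A) read ON PRINT'S χ from the re-typed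
record (`AlphaInputsT3AC.twoSidedRepOnPrintChi_dataOfV3chi`, `…RepAtHeightsChiV3Fam` §4 — the lower one-step envelope on `loPrintAC` from `StepAlphaV3ChiAC.fibre57LowOn`) in place of
the old full-window `repAtHeights_dataOfV3` (row R3D-02, refuted at `L ∈ {3,5}`, F-r1-g2-1).  The hypotheses `h2`/`h3`/`hI` below are the PROPOSED TEXTS of the successor stubs
2′χ / 3⁗χ / (i*)χ for the owner's v5kC pen (one-token successors of v5k's registered texts); `h1` is STUB 1 verbatim; `hT8` is T8 (ADD. 7).  CONDITIONAL derivation of the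
route decl's body; closes nothing by itself.

References: T. Bałaban, CMP 102 (1985) 255–275 [Balaban1985UV3] ((41) p.266, (47) p.267, Thm 2 p.272); CMP 102 (1985) 277–309 [Balaban1985Variational] (Thm 1 (8) p.279,
Prop 8 p.304); C. King, CMP 102 (1986) 649–677 [King1986] (Thm 3.4 (3.9) p.656, Props 3.8–3.9 pp.664–665); T. Bałaban, CMP 109 (1987) 249–301 [Balaban1987RG1] ((0.4) p.253).
-/

set_option autoImplicit false

noncomputable section

namespace Summit.QuantumFields.YangMills.Theorems.InteriorExcision

open MeasureTheory Filter
open Literature.MathematicalPhysics.QuantumFieldTheory.Balaban1983to89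
open Literature.MathematicalPhysics.QuantumFieldTheory.Balaban1983to89.T3ContinuumYM3Torus
open Literature.MathematicalPhysics.QuantumFieldTheory.Balaban1983to89.T3LevelShift
open Literature.MathematicalPhysics.QuantumFieldTheory.Balaban1983to89.T3UnitLawDensityEML (ℰp measurableE_ℰp)
open Literature.MathematicalPhysics.QuantumFieldTheory.Balaban1983to89.T3UnitScaleTilt
open Literature.MathematicalPhysics.QuantumFieldTheory.Balaban1983to89.T3TiltDescent
open Literature.MathematicalPhysics.QuantumFieldTheory.Balaban1983to89.T3RegularMinimiser
open Literature.MathematicalPhysics.QuantumFieldTheory.Balaban1983to89.T3PrintedRegularMinimiser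
open Literature.MathematicalPhysics.QuantumFieldTheory.Balaban1983to89.T3PrintedMinimiserExistence
open Literature.MathematicalPhysics.QuantumFieldTheory.Balaban1983to89.T3SmallLiftHistory
open Literature.MathematicalPhysics.QuantumFieldTheory.Balaban1983to89.T3LogComparisonSocket
open Literature.MathematicalPhysics.QuantumFieldTheory.Balaban1983to89.T3AlphaInputsAC
open Literature.MathematicalPhysics.QuantumFieldTheory.Balaban1983to89.T3LowerAlongMinimisersSplit (MinimisersIn8At)
open Literature.MathematicalPhysics.QuantumFieldTheory.Balaban1983to89.T3InteriorExcision
open Literature.MathematicalPhysics.QuantumFieldTheory.Balaban1983to89.Missing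
open Summit.QuantumFields.YangMills.Theorems.PrintChi
open Summit.QuantumFields.YangMills.Theorems.GlobalSlack
open Summit.QuantumFields.YangMills.Theorems.LogComparisonRepAtHeightsOn (atHeights printChiSets)

/-! ## §1 The datum at one block size from 2′χ(L) and the FULL-window slack row 3⁗χ(L) (the `L ≥ 7` currency) -/

/-- **THE DATUM-LEVEL TRIPLE AT ONE BLOCK SIZE from 2′χ(L) (`AlphaInputsT3ACv3RecChi L`) and the full-window slack row of 3⁗χ at `L`**: record `𝔠` with
`(𝔠.b₀, 𝔠.p₀) = (b₀, p₀)`, exponent `a` and the χ-package family of 3⁗χ, S-E″ `levelCauchyOfGlobalSupRateTSlack_dec` (⇒ `m₀`, full `CauchyAtHeights`, restricted to the χ-good data by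
`pintCauchyOn_of_cauchyAt`), the [7] thresholds `exists_gamma_thresholds`; the datum is `dataOfV3chi p π`, (a) by `dataOfV3chi_uminTriv`, (b) by `twoSidedRepOnPrintChi_dataOfV3chi`
(conjunct (A) ON PRINT'S χ from the re-typed row — no full-window representation anywhere). [cite: King1986, Thm 3.4 (3.9) p.656; Balaban1985UV3, (41) p.266 and (47) p.267] -/
theorem dataOnPrintChiAt_of_laneRecordsChi_slack (L : ℕ) (hLo : Odd L) (hL : 1 < L)
    (h2 : Summit.QuantumFields.YangMills.Theorems.AlphaInputsT3ACv3RecChi L)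
    (h3 : ∀ (𝔠 : Summit.QuantumFields.Balaban3D.Proofs.Primitives.AlphaConsts L (Summit.QuantumFields.Balaban3D.Carriers.suGroupModel 2).N)
      (a₀ a₁ : ℝ), 0 < a₀ → 0 < a₁ → 𝔠.B₃ * a₁ ≤ a₀ →
      ∃ a : ℝ, 0 < a ∧ ∃ γB : ℝ, 0 < γB ∧ ∀ (F : T3Family) (γ : ℝ) (hF : F.L = L) (hγ : 0 < γ), γ ≤ γB →
        ∀ (hγ1 : γ ≤ (min (hF ▸ 𝔠).gamma0 1) ^ 2),
          Summit.QuantumFields.YangMills.Theorems.AlphaInputsT3AC.OfV3ChiAt F (hF ▸ 𝔠) a₀ a₁ →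
          ∃ (p : ∀ K, Summit.QuantumFields.YangMills.Theorems.AlphaInputsT3AC.PkgAtV3Chi F (hF ▸ 𝔠) γ hγ hγ1 K),
            (∀ K, (p K).a₀ = a₀ ∧ (p K).a₁ = a₁) ∧
            ∃ (π : Summit.QuantumFields.YangMills.Theorems.AlphaInputsT3AC.PolymerT3 F) (σ : ℕ) (C : ℝ), 7 ≤ σ ∧ 0 ≤ C ∧
              GlobalSupRateTSlack (Summit.QuantumFields.YangMills.Theorems.AlphaInputsT3AC.dataOfV3chi p π) (hF ▸ 𝔠).b₀ (hF ▸ 𝔠).p₀ a σ C) :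
    ∃ (b₁ p₁ : ℝ), ∀ (b₀ p₀ : ℝ), b₁ ≤ b₀ → p₁ ≤ p₀ → 0 < b₀ → 2 < p₀ →
      ∃ ε₁ : ℝ, 0 < ε₁ ∧ ∀ (ε₀ : ℝ), 0 < ε₀ → ε₀ ≤ ε₁ → ∃ m₀ : ℕ, ∀ (m : ℕ), m₀ ≤ m →
        ∃ γ₁ : ℝ, 0 < γ₁ ∧ ∀ (F : T3Family) (γ : ℝ), F.L = L → 0 < γ → γ ≤ γ₁ →
          ∃ D : AlphaDataT3 F γ,
            (∀ (K n : ℕ) (hnK : n < K) (V : GaugeField (F.P n) 0 (Matrix.specialUnitaryGroup (Fin 2) ℂ)),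
              PlaqSmall (θBal F.L γ b₀ p₀ n) V →
                D.Umin K (K - n) (D.triv K (K - n))
                    (fieldShift (F.sitesPerDir_eq (m := F.m) (K := K) (j := K - n) (m' := F.m) (K' := n) (j' := 0) (by omega)) V) ∈
                  regFibrePr F n K hnK.le ε₀ V ∧
                wilsonAction4 (D.Umin K (K - n) (D.triv K (K - n))
                    (fieldShift (F.sitesPerDir_eq (m := F.m) (K := K) (j := K - n) (m' := F.m) (K' := n) (j' := 0) (by omega)) V)) =
                  minActionRegPr F n K hnK.le ε₀ V) ∧
            TwoSidedRepOn F γ b₀ p₀ (atHeights (printChiSets D b₀ p₀)) ε₀ D.PintH D.EcstH D.RmH ∧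
            PintCauchyOn F γ b₀ p₀
              (fun K n h V => ChiGood F γ b₀ p₀ ε₀ (1 - 2 / ((F.L : ℝ) * Real.sqrt F.L)) (n := n) (K := K) h V) m D.PintH := by
  obtain ⟨b₁, p₁, hrec⟩ := h2
  refine ⟨b₁, p₁, fun b₀ p₀ hb1 hp1 hb hp => ?_⟩
  obtain ⟨𝔠, a₀, a₁, hcb, hcp, ha0, ha1, hw, h𝔠⟩ := hrec b₀ p₀ hb1 hp1
  subst hcb
  subst hcp
  obtain ⟨a, ha, γB, hγB, hBC⟩ := h3 𝔠 a₀ a₁ ha0 ha1 hw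
  obtain ⟨εs, hεs, hS⟩ := levelCauchyOfGlobalSupRateTSlack_dec L hLo hL a ha
  refine ⟨min a₀ εs, lt_min ha0 hεs, fun ε₀ h0 h1 => ?_⟩
  have h1a : ε₀ ≤ a₀ := h1.trans (min_le_left _ _)
  have h1s : ε₀ ≤ εs := h1.trans (min_le_right _ _)
  obtain ⟨m₀, hm₀⟩ := hS ε₀ h0 h1s
  refine ⟨m₀, fun m hm => ?_⟩
  obtain ⟨γT, hγT, -, hT⟩ := Summit.QuantumFields.YangMills.Theorems.LogComparisonAlphaAdapter.exists_gamma_thresholds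
    (B₃ := 𝔠.B₃) 𝔠.b₀_pos 𝔠.p₀_pos ha1 𝔠.B₃_pos.le h0
  have hg0 : 0 < (min 𝔠.gamma0 1) ^ 2 := pow_pos (lt_min 𝔠.gamma0_pos one_pos) 2
  obtain ⟨γs, hγs, hS'⟩ := hm₀ m hm 𝔠.b₀ 𝔠.p₀ hb hp
  refine ⟨min (min γB (min γT ((min 𝔠.gamma0 1) ^ 2))) γs,
    lt_min (lt_min hγB (lt_min hγT hg0)) hγs, fun F γ hF hγ hγ₁ => ?_⟩
  subst hF
  have hγB' : γ ≤ γB := hγ₁.trans ((min_le_left _ _).trans (min_le_left _ _))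
  have hγT' : γ ≤ γT := hγ₁.trans ((min_le_left _ _).trans ((min_le_right _ _).trans (min_le_left _ _)))
  have hγ1 : γ ≤ (min 𝔠.gamma0 1) ^ 2 := hγ₁.trans ((min_le_left _ _).trans ((min_le_right _ _).trans (min_le_right _ _)))
  have hγs' : γ ≤ γs := hγ₁.trans (min_le_right _ _)
  obtain ⟨p, hp', π, σ, C, hσ, hC0, hG⟩ := hBC F γ rfl hγ hγB' hγ1 (h𝔠 F rfl)
  obtain ⟨hT1, hT2, hT3⟩ := hT F.L F.hL.2.le γ hγ hγT'
  refine ⟨Summit.QuantumFields.YangMills.Theorems.AlphaInputsT3AC.dataOfV3chi p π, fun K n hnK V hV => ?_, ?_, ?_⟩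
  · exact Summit.QuantumFields.YangMills.Theorems.AlphaInputsT3AC.dataOfV3chi_uminTriv p π K n hnK ε₀
      (by rw [(hp' K).2]; exact hT1 n) (hT2 n) (by rw [(hp' K).1]; exact h1a) V hV
  · exact Summit.QuantumFields.YangMills.Theorems.AlphaInputsT3AC.twoSidedRepOnPrintChi_dataOfV3chi p π hp' ε₀ h0 h1a hT1 hT2 hT3
  · exact pintCauchyOn_of_cauchyAt _
      (hS' F γ rfl hγ hγs' (Summit.QuantumFields.YangMills.Theorems.AlphaInputsT3AC.dataOfV3chi p π) σ C hσ hC0 hG)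

/-! ## §2 The datum at one block size from 2′χ(L) and the slack row ON χ-good data, (i*)χ at `(L, μ_L)` (the `L < 7` currency) -/

/-- **THE DATUM-LEVEL TRIPLE AT ONE BLOCK SIZE from 2′χ(L) and King's slack row read on the doubly-`ChiGood(μ_L)`-good data** ((i*)χ at margin
`μ_L = 1 − 2/(L√L)`): as §1 with the χ-restricted S-E″ `levelCauchyOnOfGlobalSupRateTSlackOn_dec` in place of S-E″. [cite: King1986, Thm 3.4 (3.9) p.656; Balaban1985UV3, (47) p.267] -/
theorem dataOnPrintChiAt_of_laneRecordsChi_slackOnChi (L : ℕ) (hLo : Odd L) (hL : 1 < L)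
    (h2 : Summit.QuantumFields.YangMills.Theorems.AlphaInputsT3ACv3RecChi L)
    (hIμ :
      ∀ (𝔠 : Summit.QuantumFields.Balaban3D.Proofs.Primitives.AlphaConsts L (Summit.QuantumFields.Balaban3D.Carriers.suGroupModel 2).N)
        (a₀ a₁ : ℝ), 0 < a₀ → 0 < a₁ → 𝔠.B₃ * a₁ ≤ a₀ →
        ∃ a : ℝ, 0 < a ∧ ∃ γB : ℝ, 0 < γB ∧ ∀ (F : T3Family) (γ : ℝ) (hF : F.L = L) (hγ : 0 < γ), γ ≤ γB →
          ∀ (hγ1 : γ ≤ (min (hF ▸ 𝔠).gamma0 1) ^ 2),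
            Summit.QuantumFields.YangMills.Theorems.AlphaInputsT3AC.OfV3ChiAt F (hF ▸ 𝔠) a₀ a₁ →
            ∃ (p : ∀ K, Summit.QuantumFields.YangMills.Theorems.AlphaInputsT3AC.PkgAtV3Chi F (hF ▸ 𝔠) γ hγ hγ1 K),
              (∀ K, (p K).a₀ = a₀ ∧ (p K).a₁ = a₁) ∧
              ∃ (π : Summit.QuantumFields.YangMills.Theorems.AlphaInputsT3AC.PolymerT3 F) (σ : ℕ) (C : ℝ), 7 ≤ σ ∧ 0 ≤ C ∧
                ∀ ε₀ : ℝ, 0 < ε₀ → ε₀ ≤ a₀ →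
                  GlobalSupRateTSlackOn
                    (fun K n h V => ChiGood F γ (hF ▸ 𝔠).b₀ (hF ▸ 𝔠).p₀ ε₀ (1 - 2 / ((L : ℝ) * Real.sqrt L)) (n := n) (K := K) h V)
                    (Summit.QuantumFields.YangMills.Theorems.AlphaInputsT3AC.dataOfV3chi p π) (hF ▸ 𝔠).b₀ (hF ▸ 𝔠).p₀ a σ C) :
    ∃ (b₁ p₁ : ℝ), ∀ (b₀ p₀ : ℝ), b₁ ≤ b₀ → p₁ ≤ p₀ → 0 < b₀ → 2 < p₀ →
      ∃ ε₁ : ℝ, 0 < ε₁ ∧ ∀ (ε₀ : ℝ), 0 < ε₀ → ε₀ ≤ ε₁ → ∃ m₀ : ℕ, ∀ (m : ℕ), m₀ ≤ m →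
        ∃ γ₁ : ℝ, 0 < γ₁ ∧ ∀ (F : T3Family) (γ : ℝ), F.L = L → 0 < γ → γ ≤ γ₁ →
          ∃ D : AlphaDataT3 F γ,
            (∀ (K n : ℕ) (hnK : n < K) (V : GaugeField (F.P n) 0 (Matrix.specialUnitaryGroup (Fin 2) ℂ)),
              PlaqSmall (θBal F.L γ b₀ p₀ n) V →
                D.Umin K (K - n) (D.triv K (K - n))
                    (fieldShift (F.sitesPerDir_eq (m := F.m) (K := K) (j := K - n) (m' := F.m) (K' := n) (j' := 0) (by omega)) V) ∈
                  regFibrePr F n K hnK.le ε₀ V ∧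
                wilsonAction4 (D.Umin K (K - n) (D.triv K (K - n))
                    (fieldShift (F.sitesPerDir_eq (m := F.m) (K := K) (j := K - n) (m' := F.m) (K' := n) (j' := 0) (by omega)) V)) =
                  minActionRegPr F n K hnK.le ε₀ V) ∧
            TwoSidedRepOn F γ b₀ p₀ (atHeights (printChiSets D b₀ p₀)) ε₀ D.PintH D.EcstH D.RmH ∧
            PintCauchyOn F γ b₀ p₀
              (fun K n h V => ChiGood F γ b₀ p₀ ε₀ (1 - 2 / ((F.L : ℝ) * Real.sqrt F.L)) (n := n) (K := K) h V) m D.PintH := by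
  obtain ⟨b₁, p₁, hrec⟩ := h2
  refine ⟨b₁, p₁, fun b₀ p₀ hb1 hp1 hb hp => ?_⟩
  obtain ⟨𝔠, a₀, a₁, hcb, hcp, ha0, ha1, hw, h𝔠⟩ := hrec b₀ p₀ hb1 hp1
  subst hcb
  subst hcp
  obtain ⟨a, ha, γB, hγB, hBC⟩ := hIμ 𝔠 a₀ a₁ ha0 ha1 hw
  obtain ⟨εs, hεs, hS⟩ := levelCauchyOnOfGlobalSupRateTSlackOn_dec L hLo hL a ha
  refine ⟨min a₀ εs, lt_min ha0 hεs, fun ε₀ h0 h1 => ?_⟩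
  have h1a : ε₀ ≤ a₀ := h1.trans (min_le_left _ _)
  have h1s : ε₀ ≤ εs := h1.trans (min_le_right _ _)
  obtain ⟨m₀, hm₀⟩ := hS ε₀ h0 h1s
  refine ⟨m₀, fun m hm => ?_⟩
  obtain ⟨γT, hγT, -, hT⟩ := Summit.QuantumFields.YangMills.Theorems.LogComparisonAlphaAdapter.exists_gamma_thresholds
    (B₃ := 𝔠.B₃) 𝔠.b₀_pos 𝔠.p₀_pos ha1 𝔠.B₃_pos.le h0
  have hg0 : 0 < (min 𝔠.gamma0 1) ^ 2 := pow_pos (lt_min 𝔠.gamma0_pos one_pos) 2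
  obtain ⟨γs, hγs, hS'⟩ := hm₀ m hm 𝔠.b₀ 𝔠.p₀ hb hp
  refine ⟨min (min γB (min γT ((min 𝔠.gamma0 1) ^ 2))) γs,
    lt_min (lt_min hγB (lt_min hγT hg0)) hγs, fun F γ hF hγ hγ₁ => ?_⟩
  subst hF
  have hγB' : γ ≤ γB := hγ₁.trans ((min_le_left _ _).trans (min_le_left _ _))
  have hγT' : γ ≤ γT := hγ₁.trans ((min_le_left _ _).trans ((min_le_right _ _).trans (min_le_left _ _)))
  have hγ1 : γ ≤ (min 𝔠.gamma0 1) ^ 2 := hγ₁.trans ((min_le_left _ _).trans ((min_le_right _ _).trans (min_le_right _ _)))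
  have hγs' : γ ≤ γs := hγ₁.trans (min_le_right _ _)
  obtain ⟨p, hp', π, σ, C, hσ, hC0, hG⟩ := hBC F γ rfl hγ hγB' hγ1 (h𝔠 F rfl)
  obtain ⟨hT1, hT2, hT3⟩ := hT F.L F.hL.2.le γ hγ hγT'
  refine ⟨Summit.QuantumFields.YangMills.Theorems.AlphaInputsT3AC.dataOfV3chi p π, fun K n hnK V hV => ?_, ?_, ?_⟩
  · exact Summit.QuantumFields.YangMills.Theorems.AlphaInputsT3AC.dataOfV3chi_uminTriv p π K n hnK ε₀
      (by rw [(hp' K).2]; exact hT1 n) (hT2 n) (by rw [(hp' K).1]; exact h1a) V hV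
  · exact Summit.QuantumFields.YangMills.Theorems.AlphaInputsT3AC.twoSidedRepOnPrintChi_dataOfV3chi p π hp' ε₀ h0 h1a hT1 hT2 hT3
  · exact hS' F γ rfl hγ hγs' _ (Summit.QuantumFields.YangMills.Theorems.AlphaInputsT3AC.dataOfV3chi p π) σ C hσ hC0 (hG ε₀ h0 h1a)

/-! ## §3 Every odd block size: 2′χ ∧ 3⁗χ (`L ≥ 7`) ∧ (i*)χ (`L < 7`) ⟹ the engine's `hData` -/

/-- **THE ENGINE'S DATUM-LEVEL HYPOTHESIS `hData` FROM THE THREE ONE-TOKEN SUCCESSOR STUBS OF v5kC** (OWNER RULING g23-№2 ADD. 6: skeleton v5k's texts with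
`AlphaInputsT3ACv3Rec ↦ …RecChi`, `OfV3At ↦ OfV3ChiAt`, `PkgAtV3 ↦ PkgAtV3Chi`, `dataOfV3 ↦ dataOfV3chi`, everything else byte-identical): 2′χ, 3⁗χ (`L ≥ 7`, §1) and (i*)χ
(odd `L < 7`, at margin `μ_L ∈ (0,1)` by `muL_pos_lt_one`, §2). [cite: King1986, Thm 3.4 (3.9) p.656; Balaban1985UV3, (41) p.266 and (47) p.267] -/
theorem dataOnPrintChi_of_v3ChiStubs
    (h2 : ∀ L : ℕ, Odd L → 1 < L → Summit.QuantumFields.YangMills.Theorems.AlphaInputsT3ACv3RecChi L)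
    (h3 : ∀ (L : ℕ), Odd L → 7 ≤ L → ∀ (𝔠 : Summit.QuantumFields.Balaban3D.Proofs.Primitives.AlphaConsts L (Summit.QuantumFields.Balaban3D.Carriers.suGroupModel 2).N)
      (a₀ a₁ : ℝ), 0 < a₀ → 0 < a₁ → 𝔠.B₃ * a₁ ≤ a₀ →
      ∃ a : ℝ, 0 < a ∧ ∃ γB : ℝ, 0 < γB ∧ ∀ (F : T3Family) (γ : ℝ) (hF : F.L = L) (hγ : 0 < γ), γ ≤ γB →
        ∀ (hγ1 : γ ≤ (min (hF ▸ 𝔠).gamma0 1) ^ 2),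
          Summit.QuantumFields.YangMills.Theorems.AlphaInputsT3AC.OfV3ChiAt F (hF ▸ 𝔠) a₀ a₁ →
          ∃ (p : ∀ K, Summit.QuantumFields.YangMills.Theorems.AlphaInputsT3AC.PkgAtV3Chi F (hF ▸ 𝔠) γ hγ hγ1 K),
            (∀ K, (p K).a₀ = a₀ ∧ (p K).a₁ = a₁) ∧
            ∃ (π : Summit.QuantumFields.YangMills.Theorems.AlphaInputsT3AC.PolymerT3 F) (σ : ℕ) (C : ℝ), 7 ≤ σ ∧ 0 ≤ C ∧
              GlobalSupRateTSlack (Summit.QuantumFields.YangMills.Theorems.AlphaInputsT3AC.dataOfV3chi p π) (hF ▸ 𝔠).b₀ (hF ▸ 𝔠).p₀ a σ C)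
    (hI : ∀ (L : ℕ), Odd L → 1 < L → L < 7 → ∀ (μ : ℝ), 0 < μ → μ < 1 →
      ∀ (𝔠 : Summit.QuantumFields.Balaban3D.Proofs.Primitives.AlphaConsts L (Summit.QuantumFields.Balaban3D.Carriers.suGroupModel 2).N)
        (a₀ a₁ : ℝ), 0 < a₀ → 0 < a₁ → 𝔠.B₃ * a₁ ≤ a₀ →
        ∃ a : ℝ, 0 < a ∧ ∃ γB : ℝ, 0 < γB ∧ ∀ (F : T3Family) (γ : ℝ) (hF : F.L = L) (hγ : 0 < γ), γ ≤ γB →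
          ∀ (hγ1 : γ ≤ (min (hF ▸ 𝔠).gamma0 1) ^ 2),
            Summit.QuantumFields.YangMills.Theorems.AlphaInputsT3AC.OfV3ChiAt F (hF ▸ 𝔠) a₀ a₁ →
            ∃ (p : ∀ K, Summit.QuantumFields.YangMills.Theorems.AlphaInputsT3AC.PkgAtV3Chi F (hF ▸ 𝔠) γ hγ hγ1 K),
              (∀ K, (p K).a₀ = a₀ ∧ (p K).a₁ = a₁) ∧
              ∃ (π : Summit.QuantumFields.YangMills.Theorems.AlphaInputsT3AC.PolymerT3 F) (σ : ℕ) (C : ℝ), 7 ≤ σ ∧ 0 ≤ C ∧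
                ∀ ε₀ : ℝ, 0 < ε₀ → ε₀ ≤ a₀ →
                  GlobalSupRateTSlackOn (fun K n h V => ChiGood F γ (hF ▸ 𝔠).b₀ (hF ▸ 𝔠).p₀ ε₀ μ (n := n) (K := K) h V)
                    (Summit.QuantumFields.YangMills.Theorems.AlphaInputsT3AC.dataOfV3chi p π) (hF ▸ 𝔠).b₀ (hF ▸ 𝔠).p₀ a σ C) :
    ∀ L : ℕ, Odd L → 1 < L → ∃ (b₁ p₁ : ℝ), ∀ (b₀ p₀ : ℝ), b₁ ≤ b₀ → p₁ ≤ p₀ → 0 < b₀ → 2 < p₀ →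
      ∃ ε₁ : ℝ, 0 < ε₁ ∧ ∀ (ε₀ : ℝ), 0 < ε₀ → ε₀ ≤ ε₁ → ∃ m₀ : ℕ, ∀ (m : ℕ), m₀ ≤ m →
        ∃ γ₁ : ℝ, 0 < γ₁ ∧ ∀ (F : T3Family) (γ : ℝ), F.L = L → 0 < γ → γ ≤ γ₁ →
          ∃ D : AlphaDataT3 F γ,
            (∀ (K n : ℕ) (hnK : n < K) (V : GaugeField (F.P n) 0 (Matrix.specialUnitaryGroup (Fin 2) ℂ)),
              PlaqSmall (θBal F.L γ b₀ p₀ n) V →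
                D.Umin K (K - n) (D.triv K (K - n))
                    (fieldShift (F.sitesPerDir_eq (m := F.m) (K := K) (j := K - n) (m' := F.m) (K' := n) (j' := 0) (by omega)) V) ∈
                  regFibrePr F n K hnK.le ε₀ V ∧
                wilsonAction4 (D.Umin K (K - n) (D.triv K (K - n))
                    (fieldShift (F.sitesPerDir_eq (m := F.m) (K := K) (j := K - n) (m' := F.m) (K' := n) (j' := 0) (by omega)) V)) =
                  minActionRegPr F n K hnK.le ε₀ V) ∧
            TwoSidedRepOn F γ b₀ p₀ (atHeights (printChiSets D b₀ p₀)) ε₀ D.PintH D.EcstH D.RmH ∧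
            PintCauchyOn F γ b₀ p₀
              (fun K n h V => ChiGood F γ b₀ p₀ ε₀ (1 - 2 / ((F.L : ℝ) * Real.sqrt F.L)) (n := n) (K := K) h V) m D.PintH := by
  intro L hLo hL
  by_cases h7 : 7 ≤ L
  · exact dataOnPrintChiAt_of_laneRecordsChi_slack L hLo hL (h2 L hLo hL) (h3 L hLo h7)
  · have hμ := muL_pos_lt_one hL
    exact dataOnPrintChiAt_of_laneRecordsChi_slackOnChi L hLo hL (h2 L hLo hL)
      (fun 𝔠 a₀ a₁ ha0 ha1 hw => hI L hLo hL (not_le.mp h7) _ hμ.1 hμ.2 𝔠 a₀ a₁ ha0 ha1 hw)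

/-! ## §4 The capstone: v5kC's §2 by name -/

/-- **v5kC §2 — `FluctuationComparisonRegPrIntL ⇐ STUB 1 ∧ T8 ∧ 2′χ ∧ 3⁗χ ∧ (i*)χ`, THROUGH PRINT'S χ OF THE DATUM'S OWN MINIMISER.**  The re-typed item from the
five stubs of the R-57χ skeleton (OWNER RULING g23-№2 + ADD. 6/7): window positivity from STUB 1 (`OneStepSubmersion.posOnSmall_of_oneStepSmallLift`, p446430 ∘ p490827), T8 =
[Balaban1985Variational] Thm 1 ∃-form ∧ (8) ∀-form at every odd `L > 1` (ADD. 7; crux `MinimiserStabilityRegPr`'s `variational_of_leaves_log` via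
`InteriorExcision.thm1In8_of_attained_of_in8`), 2′χ `AlphaInputsT3ACv3RecChi` (★alpha-1's re-typed record: print's lower row on `loPrintAC`), 3⁗χ / (i*)χ (King's slack row, full
window at `L ≥ 7` / on χ-good data at odd `L < 7`, over the χ-package family and its datum `dataOfV3chi`); composition = the record-free engine
`InteriorExcision.regPrIntL_of_dataOnPrintChi` (p550585) fed by §3.  Interior constant `c := (max B₃ 1)⁻¹`, `m₀ ≥ 2`, ONE chain for every odd `L`; no edge clause, no `K = 0` corner.
CONDITIONAL on the five hypotheses; nothing of [Balaban1985UV3]/[King1986]/[Balaban1985Variational] is asserted. [cite: Balaban1985UV3, (41) p.266, (47) p.267 and Thm 2 p.272;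
King1986, Prop. 3.8-3.9 pp.664-665; Balaban1985Variational, Thm 1 (8) p.279] -/
theorem regPrIntL_of_v3ChiStubs
    (h1 : ∀ L : ℕ, ∃ κ δ₀ : ℝ, κ * Real.sqrt L ≤ 1 ∧ 0 < δ₀ ∧ ∀ F : T3Family, F.L = L → OneStepSmallLift F ℰp κ δ₀)
    (hT8 : ∀ L : ℕ, Odd L → 1 < L → ∃ a₀ a₁ B₃ : ℝ, 0 < a₀ ∧ 0 < a₁ ∧ 0 < B₃ ∧
      Thm1GlobalMinAt L a₀ a₁ B₃ ∧ MinimisersIn8At L a₀ a₁ B₃)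
    (h2 : ∀ L : ℕ, Odd L → 1 < L → Summit.QuantumFields.YangMills.Theorems.AlphaInputsT3ACv3RecChi L)
    (h3 : ∀ (L : ℕ), Odd L → 7 ≤ L → ∀ (𝔠 : Summit.QuantumFields.Balaban3D.Proofs.Primitives.AlphaConsts L (Summit.QuantumFields.Balaban3D.Carriers.suGroupModel 2).N)
      (a₀ a₁ : ℝ), 0 < a₀ → 0 < a₁ → 𝔠.B₃ * a₁ ≤ a₀ →
      ∃ a : ℝ, 0 < a ∧ ∃ γB : ℝ, 0 < γB ∧ ∀ (F : T3Family) (γ : ℝ) (hF : F.L = L) (hγ : 0 < γ), γ ≤ γB →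
        ∀ (hγ1 : γ ≤ (min (hF ▸ 𝔠).gamma0 1) ^ 2),
          Summit.QuantumFields.YangMills.Theorems.AlphaInputsT3AC.OfV3ChiAt F (hF ▸ 𝔠) a₀ a₁ →
          ∃ (p : ∀ K, Summit.QuantumFields.YangMills.Theorems.AlphaInputsT3AC.PkgAtV3Chi F (hF ▸ 𝔠) γ hγ hγ1 K),
            (∀ K, (p K).a₀ = a₀ ∧ (p K).a₁ = a₁) ∧
            ∃ (π : Summit.QuantumFields.YangMills.Theorems.AlphaInputsT3AC.PolymerT3 F) (σ : ℕ) (C : ℝ), 7 ≤ σ ∧ 0 ≤ C ∧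
              GlobalSupRateTSlack (Summit.QuantumFields.YangMills.Theorems.AlphaInputsT3AC.dataOfV3chi p π) (hF ▸ 𝔠).b₀ (hF ▸ 𝔠).p₀ a σ C)
    (hI : ∀ (L : ℕ), Odd L → 1 < L → L < 7 → ∀ (μ : ℝ), 0 < μ → μ < 1 →
      ∀ (𝔠 : Summit.QuantumFields.Balaban3D.Proofs.Primitives.AlphaConsts L (Summit.QuantumFields.Balaban3D.Carriers.suGroupModel 2).N)
        (a₀ a₁ : ℝ), 0 < a₀ → 0 < a₁ → 𝔠.B₃ * a₁ ≤ a₀ →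
        ∃ a : ℝ, 0 < a ∧ ∃ γB : ℝ, 0 < γB ∧ ∀ (F : T3Family) (γ : ℝ) (hF : F.L = L) (hγ : 0 < γ), γ ≤ γB →
          ∀ (hγ1 : γ ≤ (min (hF ▸ 𝔠).gamma0 1) ^ 2),
            Summit.QuantumFields.YangMills.Theorems.AlphaInputsT3AC.OfV3ChiAt F (hF ▸ 𝔠) a₀ a₁ →
            ∃ (p : ∀ K, Summit.QuantumFields.YangMills.Theorems.AlphaInputsT3AC.PkgAtV3Chi F (hF ▸ 𝔠) γ hγ hγ1 K),
              (∀ K, (p K).a₀ = a₀ ∧ (p K).a₁ = a₁) ∧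
              ∃ (π : Summit.QuantumFields.YangMills.Theorems.AlphaInputsT3AC.PolymerT3 F) (σ : ℕ) (C : ℝ), 7 ≤ σ ∧ 0 ≤ C ∧
                ∀ ε₀ : ℝ, 0 < ε₀ → ε₀ ≤ a₀ →
                  GlobalSupRateTSlackOn (fun K n h V => ChiGood F γ (hF ▸ 𝔠).b₀ (hF ▸ 𝔠).p₀ ε₀ μ (n := n) (K := K) h V)
                    (Summit.QuantumFields.YangMills.Theorems.AlphaInputsT3AC.dataOfV3chi p π) (hF ▸ 𝔠).b₀ (hF ▸ 𝔠).p₀ a σ C) :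
    FluctuationComparisonRegPrIntL :=
  regPrIntL_of_dataOnPrintChi hT8 (dataOnPrintChi_of_v3ChiStubs h2 h3 hI)
    (Summit.QuantumFields.YangMills.Theorems.OneStepSubmersion.posOnSmall_of_oneStepSmallLift h1)

end Summit.QuantumFields.YangMills.Theorems.InteriorExcision

end
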